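import Mathlib
import HarnessLib
import Literature.MathematicalPhysics.QuantumManyBody.BoseGasFreeDirichletBEC
import Literature.MathematicalPhysics.QuantumManyBody.BoseGasHardCoreCriticalDensity
import Literature.MathematicalPhysics.QuantumManyBody.OneParticleMarginals
import Literature.MathematicalPhysics.QuantumManyBody.BoseGasProductState
import Summits.AtomisticToContinuum.BoseEinsteinCondensation.Theorems.NumberPhaseSandwichHardCoreRung
import Summits.AtomisticToContinuum.BoseEinsteinCondensation.Theorems.NumberPhaseSandwichNearPivotCompare

/-! # NumberPhaseSandwich · crux P3 `WallLayerMass` HOLDS FOR GENUINE HARD CORES (v-pointwise instance)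

Route NumberPhaseSandwich (decomp-a2c lens-6 g10), crux `WallLayerMass` (stmt-AtomisticToContinuum-32639, rank 4): in the
pivot window, for every level `1 ≤ k ≤ K`, the one-body mass of the level-`k` cells whose parent is NOT interior is
`≤ A q^k N`. For a potential with a genuine hard core (`v = ⊤` on `[0,a)`) this is PACKING: on `supp Ψ` the particles are
`a`-separated (tree `eq_zero_of_dist_le`), a cell of side `ℓ` (diameter `< 2ℓ`) holds `≤ (4ℓ/a+2)³` of them (tree
`card_filter_dist_lt_le_pow`), there are `≤ 12·4^k` wall cells (a coordinate of `c` lies in `{0,1,2^k−2,2^k−1}`), and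
`ℓ_k = L/2^k ≥ 1/√ρ` in the window, so the wall mass is `≤ 12·4^k·ℓ_k³(4/a+2√ρ)³ = 12(4/a+2√ρ)³/ρ · 2^{-k} · N`
(`L³ = N/ρ`): `A = 12(4/a+2√ρ)³/ρ`, `q = 1/2`; finite energy eventually from `limsup_lt_top_of_small`. So P3's content is the
SOFT-potential regime (no packing), exactly as for I3 (`NumberPhaseSandwichHardCoreRung`). 0 sorry. -/

noncomputable section

namespace Summit.AtomisticToContinuum.BoseEinsteinCondensation.Theorems.NumberPhaseSandwichHardCoreWall

open Literature.MathematicalPhysics.QuantumManyBody.BoseGas MeasureTheory Set Filter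
open scoped ENNReal NNReal
open Summit.AtomisticToContinuum.BoseEinsteinCondensation.Theorems.NumberPhaseSandwichHardCoreRung (eventually_groundStateEnergy_lt_top sum_indicator_eq_card)
open Summit.AtomisticToContinuum.BoseEinsteinCondensation.Theorems.NumberPhaseSandwichNearPivotCompare (lintegral_shellCount_eq)

variable {N M : ℕ} {ℓ L : ℝ}
/-- verbatim skeleton object (interior parent). -/
abbrev IntP (k : ℕ) (c : SubIdx (2 ^ k)) : Prop := ∀ j : Fin 3, 1 ≤ (c j : ℕ) / 2 ∧ (c j : ℕ) / 2 + 2 ≤ 2 ^ (k - 1)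
/-! ## Counting the wall cells: `#{c : ¬ IntP k c} ≤ 12 · 4^k` -/
/-- a fibre `{c | c j = b}` of `Fin 3 → Fin M` has at most `M²` elements (inject by restriction to the other two
coordinates). -/
theorem card_fiber_le (M : ℕ) (j : Fin 3) (b : Fin M) :
    (Finset.univ.filter fun c : SubIdx M => c j = b).card ≤ M ^ 2 := by
  classical
  have hcard : (Finset.univ : Finset (Fin 2 → Fin M)).card = M ^ 2 := by
    simp [Finset.card_univ, Fintype.card_pi, Finset.prod_const]
  rw [← hcard]
  refine Finset.card_le_card_of_injOn (fun c => c ∘ j.succAbove) (fun c _ => Finset.mem_coe.2 (Finset.mem_univ _)) ?_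
  intro c hc c' hc' h
  have hcj : c j = b := (Finset.mem_filter.1 (Finset.mem_coe.1 hc)).2
  have hc'j : c' j = b := (Finset.mem_filter.1 (Finset.mem_coe.1 hc')).2
  funext i
  by_cases hij : i = j
  · rw [hij, hcj, hc'j]
  · obtain ⟨t, rfl⟩ := Fin.exists_succAbove_eq hij
    exact congrFun h t
/-- the boundary values of one coordinate: at most four of them. -/
theorem card_bvals_le (M : ℕ) :
    (Finset.univ.filter fun b : Fin M => (b : ℕ) ≤ 1 ∨ M ≤ (b : ℕ) + 2).card ≤ 4 := by
  classical
  have hsub : ∀ b ∈ (Finset.univ.filter fun b : Fin M => (b : ℕ) ≤ 1 ∨ M ≤ (b : ℕ) + 2),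
      (fun b : Fin M => (b : ℕ)) b ∈ (({0, 1, M - 2, M - 1} : Finset ℕ) : Set ℕ) := by
    intro b hb
    have h := (Finset.mem_filter.1 hb).2
    have hbM : (b : ℕ) < M := b.isLt
    simp only [Finset.coe_insert, Finset.coe_singleton, Set.mem_insert_iff, Set.mem_singleton_iff]
    omega
  have hinj : Set.InjOn (fun b : Fin M => (b : ℕ))
      ((Finset.univ.filter fun b : Fin M => (b : ℕ) ≤ 1 ∨ M ≤ (b : ℕ) + 2) : Set (Fin M)) :=
    fun b _ b' _ h => Fin.ext h
  refine (Finset.card_le_card_of_injOn _ hsub hinj).trans ?_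
  refine (Finset.card_insert_le _ _).trans ?_
  refine (Nat.add_le_add_right (Finset.card_insert_le _ _) 1).trans ?_
  refine (Nat.add_le_add_right (Nat.add_le_add_right (Finset.card_insert_le _ _) 1) 1).trans ?_
  simp
/-- cells with a non-interior parent, one coordinate at a time: `≤ 4M²`. -/
theorem card_bad_coord_le (M : ℕ) (j : Fin 3) :
    (Finset.univ.filter fun c : SubIdx M => (c j : ℕ) ≤ 1 ∨ M ≤ (c j : ℕ) + 2).card ≤ 4 * M ^ 2 := by
  classical
  set B := Finset.univ.filter fun b : Fin M => (b : ℕ) ≤ 1 ∨ M ≤ (b : ℕ) + 2 with hB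
  have hsub : (Finset.univ.filter fun c : SubIdx M => (c j : ℕ) ≤ 1 ∨ M ≤ (c j : ℕ) + 2) ⊆
      B.biUnion fun b => Finset.univ.filter fun c : SubIdx M => c j = b := by
    intro c hc
    have h := (Finset.mem_filter.1 hc).2
    exact Finset.mem_biUnion.2 ⟨c j, Finset.mem_filter.2 ⟨Finset.mem_univ _, h⟩,
      Finset.mem_filter.2 ⟨Finset.mem_univ _, rfl⟩⟩
  calc (Finset.univ.filter fun c : SubIdx M => (c j : ℕ) ≤ 1 ∨ M ≤ (c j : ℕ) + 2).card
      ≤ (B.biUnion fun b => Finset.univ.filter fun c : SubIdx M => c j = b).card := Finset.card_le_card hsub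
    _ ≤ ∑ b ∈ B, (Finset.univ.filter fun c : SubIdx M => c j = b).card := Finset.card_biUnion_le
    _ ≤ ∑ _b ∈ B, M ^ 2 := Finset.sum_le_sum fun b _ => card_fiber_le M j b
    _ = B.card * M ^ 2 := by rw [Finset.sum_const, smul_eq_mul]
    _ ≤ 4 * M ^ 2 := Nat.mul_le_mul_right _ (card_bvals_le M)
/-- **the wall-layer count**: at most `12 · 4^k` level-`k` cells have a non-interior parent. -/
theorem card_wall_le (k : ℕ) :
    (Finset.univ.filter fun c : SubIdx (2 ^ k) => ¬ IntP k c).card ≤ 12 * 4 ^ k := by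
  classical
  rcases Nat.eq_zero_or_pos k with rfl | hk
  · -- one cell
    calc (Finset.univ.filter fun c : SubIdx (2 ^ 0) => ¬ IntP 0 c).card ≤ (Finset.univ : Finset (SubIdx (2 ^ 0))).card :=
          Finset.card_filter_le _ _
      _ = 1 := by simp
      _ ≤ 12 * 4 ^ 0 := by norm_num
  · set M := 2 ^ k with hM
    have hM2 : M = 2 * 2 ^ (k - 1) := by
      rw [hM, ← pow_succ']; congr 1; omega
    have hsub : (Finset.univ.filter fun c : SubIdx M => ¬ IntP k c) ⊆
        (Finset.univ : Finset (Fin 3)).biUnion fun j =>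
          Finset.univ.filter fun c : SubIdx M => (c j : ℕ) ≤ 1 ∨ M ≤ (c j : ℕ) + 2 := by
      intro c hc
      have h := (Finset.mem_filter.1 hc).2
      simp only [IntP, not_forall, not_and_or, not_le] at h
      obtain ⟨j, hj⟩ := h
      refine Finset.mem_biUnion.2 ⟨j, Finset.mem_univ _, Finset.mem_filter.2 ⟨Finset.mem_univ _, ?_⟩⟩
      rcases hj with hj | hj <;> omega
    calc (Finset.univ.filter fun c : SubIdx M => ¬ IntP k c).card
        ≤ ((Finset.univ : Finset (Fin 3)).biUnion fun j =>
            Finset.univ.filter fun c : SubIdx M => (c j : ℕ) ≤ 1 ∨ M ≤ (c j : ℕ) + 2).card := Finset.card_le_card hsub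
      _ ≤ ∑ j : Fin 3, (Finset.univ.filter fun c : SubIdx M => (c j : ℕ) ≤ 1 ∨ M ≤ (c j : ℕ) + 2).card :=
          Finset.card_biUnion_le
      _ ≤ ∑ _j : Fin 3, 4 * M ^ 2 := Finset.sum_le_sum fun j _ => card_bad_coord_le M j
      _ = 12 * 4 ^ k := by
          rw [Finset.sum_const, Finset.card_univ, Fintype.card_fin, smul_eq_mul, hM, ← pow_mul,
            show (2 : ℕ) ^ (k * 2) = 4 ^ k by rw [mul_comm, pow_mul]; norm_num]
          ring
/-! ## Packing in one cell -/
/-- two points of one cell are `< 2ℓ` apart. -/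
theorem dist_lt_of_mem_subCell (hℓ : 0 < ℓ) (c : SubIdx M) {x y : Space} (hx : x ∈ subCell ℓ c)
    (hy : y ∈ subCell ℓ c) : dist x y < 2 * ℓ := by
  have hsq : dist x y ^ 2 < (2 * ℓ) ^ 2 := by
    rw [dist_sq_eq_sum_coord]
    have hj : ∀ j : Fin 3, (x j - y j) ^ 2 < ℓ ^ 2 := fun j => by
      have h1 := (mem_subCell.1 hx) j
      have h2 := (mem_subCell.1 hy) j
      have h : |x j - y j| < ℓ := by rw [abs_lt]; constructor <;> linarith [h1.1, h1.2, h2.1, h2.2]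
      exact sq_lt_sq' (by linarith [(abs_lt.1 h).1]) (abs_lt.1 h).2
    calc ∑ j : Fin 3, (x j - y j) ^ 2 < ∑ _j : Fin 3, ℓ ^ 2 :=
          Finset.sum_lt_sum_of_nonempty Finset.univ_nonempty fun j _ => hj j
      _ = 3 * ℓ ^ 2 := by simp
      _ ≤ (2 * ℓ) ^ 2 := by nlinarith
  exact lt_of_pow_lt_pow_left₀ 2 (by positivity) hsq

/-- **packing**: `a`-separated particles — at most `(4ℓ/a+2)³` per cell of side `ℓ`. -/
theorem card_cell_le {a : ℝ} (ha : 0 < a) (hℓ : 0 < ℓ) (c : SubIdx M) {X : Config N}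
    (hsep : ∀ j j' : Fin N, j ≠ j' → a ≤ dist (X j) (X j')) [DecidablePred fun p : Fin N => X p ∈ subCell ℓ c] :
    ((Finset.univ.filter fun p => X p ∈ subCell ℓ c).card : ℝ) ≤ (4 * ℓ / a + 2) ^ 3 := by
  classical
  set F := Finset.univ.filter fun p => X p ∈ subCell ℓ c with hF
  rcases F.eq_empty_or_nonempty with h0 | ⟨i, hi⟩
  · rw [h0]; simp; positivity
  · have hiP : X i ∈ subCell ℓ c := (Finset.mem_filter.1 hi).2
    have hsub : F ⊆ insert i (Finset.univ.filter fun j => j ≠ i ∧ dist (X i) (X j) < 2 * ℓ) := by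
      intro p hp
      have hpP : X p ∈ subCell ℓ c := (Finset.mem_filter.1 hp).2
      by_cases hpi : p = i
      · exact Finset.mem_insert.2 (Or.inl hpi)
      · exact Finset.mem_insert.2 (Or.inr (Finset.mem_filter.2 ⟨Finset.mem_univ _, hpi,
          dist_lt_of_mem_subCell hℓ c hiP hpP⟩))
    have h1 : (F.card : ℝ) ≤ 1 + ((Finset.univ.filter fun j => j ≠ i ∧ dist (X i) (X j) < 2 * ℓ).card : ℝ) := by
      have := (Finset.card_le_card hsub).trans (Finset.card_insert_le _ _)
      have h' : (F.card : ℝ) ≤ (((Finset.univ.filter fun j => j ≠ i ∧ dist (X i) (X j) < 2 * ℓ).card + 1 : ℕ) : ℝ) := by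
        exact_mod_cast this
      push_cast at h'; linarith
    have h2 := card_filter_dist_lt_le_pow ha (by positivity : (0 : ℝ) < 2 * ℓ) hsep i
    have h3 : (2 * (2 * ℓ) / a + 1) = 4 * ℓ / a + 1 := by ring
    rw [h3] at h2
    have h4 : 1 + (4 * ℓ / a + 1) ^ 3 ≤ (4 * ℓ / a + 2) ^ 3 := by
      have : 0 ≤ 4 * ℓ / a := by positivity
      nlinarith [this, sq_nonneg (4 * ℓ / a + 1)]
    linarith

/-! ## The wall count on `supp Ψ`, pointwise and integrated -/

/-- the summed wall-cell particle count. -/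
abbrev wallCount (ℓ : ℝ) (k : ℕ) (X : Config N) : ℝ≥0∞ :=
  ∑ c ∈ Finset.univ.filter (fun c : SubIdx (2 ^ k) => ¬ IntP k c),
    ∑ p : Fin N, (subCell ℓ c).indicator (fun _ => (1 : ℝ≥0∞)) (X p)

/-- **pointwise**: `W(X)·|Ψ(X)|² ≤ 12·4^k·(4ℓ/a+2)³ · |Ψ(X)|²` for a finite-energy state of a hard-core gas. -/
theorem wallCount_mul_le {a : ℝ} (ha : 0 < a) {v : ℝ → ℝ≥0∞} (hcore : ∀ r, r < a → v r = ⊤)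
    (Ψ : TrialState N L) (hE : energy v Ψ ≠ ⊤) (hℓ : 0 < ℓ) (k : ℕ) (X : Config N) :
    wallCount ℓ k X * (‖Ψ.ψ X‖₊ : ℝ≥0∞) ^ 2 ≤
      ENNReal.ofReal (12 * 4 ^ k * (4 * ℓ / a + 2) ^ 3) * (‖Ψ.ψ X‖₊ : ℝ≥0∞) ^ 2 := by
  classical
  by_cases hX : Ψ.ψ X = 0
  · simp [hX]
  · have hsep : ∀ j j' : Fin N, j ≠ j' → a ≤ dist (X j) (X j') := by
      intro j j' hjj'
      by_contra hlt
      exact hX (eq_zero_of_dist_le ha hcore Ψ.contDiff.continuous hE X j j' hjj' (not_le.1 hlt).le)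
    refine mul_le_mul' ?_ le_rfl
    have hnn : (0 : ℝ) ≤ (4 * ℓ / a + 2) ^ 3 := by positivity
    calc wallCount ℓ k X
        = ∑ c ∈ Finset.univ.filter (fun c : SubIdx (2 ^ k) => ¬ IntP k c),
            ((Finset.univ.filter fun p => X p ∈ subCell ℓ c).card : ℝ≥0∞) := by
          refine Finset.sum_congr rfl fun c _ => ?_
          rw [sum_indicator_eq_card]
      _ ≤ ∑ _c ∈ Finset.univ.filter (fun c : SubIdx (2 ^ k) => ¬ IntP k c), ENNReal.ofReal ((4 * ℓ / a + 2) ^ 3) := by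
          refine Finset.sum_le_sum fun c _ => ?_
          rw [← ENNReal.ofReal_natCast]
          exact ENNReal.ofReal_le_ofReal (card_cell_le ha hℓ c hsep)
      _ = ((Finset.univ.filter fun c : SubIdx (2 ^ k) => ¬ IntP k c).card : ℝ≥0∞) *
            ENNReal.ofReal ((4 * ℓ / a + 2) ^ 3) := by rw [Finset.sum_const, nsmul_eq_mul]
      _ ≤ ENNReal.ofReal (12 * 4 ^ k) * ENNReal.ofReal ((4 * ℓ / a + 2) ^ 3) := by
          refine mul_le_mul' ?_ le_rfl
          rw [← ENNReal.ofReal_natCast]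
          exact ENNReal.ofReal_le_ofReal (by exact_mod_cast card_wall_le k)
      _ = ENNReal.ofReal (12 * 4 ^ k * (4 * ℓ / a + 2) ^ 3) := by
          rw [← ENNReal.ofReal_mul (by positivity)]

/-- **integrated wall mass** for a finite-energy state of a hard-core gas: `Σ_{wall c} ∫_{Q_c} ρ_Ψ ≤ 12·4^k(4ℓ/a+2)³`. -/
theorem wallMass_le {a : ℝ} (ha : 0 < a) {v : ℝ → ℝ≥0∞} (hcore : ∀ r, r < a → v r = ⊤)
    (Ψ : TrialState (N + 1) L) (hE : energy v Ψ ≠ ⊤) (hℓ : 0 < ℓ) (k : ℕ) :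
    ∑ c ∈ Finset.univ.filter (fun c : SubIdx (2 ^ k) => ¬ IntP k c),
        ∫⁻ x in subCell ℓ c, oneParticleDensity (N + 1) Ψ.ψ x ≤
      ENNReal.ofReal (12 * 4 ^ k * (4 * ℓ / a + 2) ^ 3) := by
  have hψm : Measurable Ψ.ψ := Ψ.contDiff.continuous.measurable
  have hnorm : Measurable fun X : Config (N + 1) => (‖Ψ.ψ X‖₊ : ℝ≥0∞) ^ 2 :=
    hψm.nnnorm.coe_nnreal_ennreal.pow_const 2
  have hcnt : ∀ c : SubIdx (2 ^ k), Measurable fun X : Config (N + 1) =>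
      ∑ p : Fin (N + 1), (subCell ℓ c).indicator (fun _ => (1 : ℝ≥0∞)) (X p) := fun c =>
    Finset.measurable_sum _ fun p _ => (measurable_const.indicator (measurableSet_subCell ℓ c)).comp
      (measurable_pi_apply p)
  calc ∑ c ∈ Finset.univ.filter (fun c : SubIdx (2 ^ k) => ¬ IntP k c),
        ∫⁻ x in subCell ℓ c, oneParticleDensity (N + 1) Ψ.ψ x
      = ∑ c ∈ Finset.univ.filter (fun c : SubIdx (2 ^ k) => ¬ IntP k c),
          ∫⁻ X, (∑ p : Fin (N + 1), (subCell ℓ c).indicator (fun _ => (1 : ℝ≥0∞)) (X p)) *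
            (‖Ψ.ψ X‖₊ : ℝ≥0∞) ^ 2 := by
        refine Finset.sum_congr rfl fun c _ => ?_
        rw [lintegral_shellCount_eq Ψ (measurableSet_subCell ℓ c)]
    _ = ∫⁻ X, ∑ c ∈ Finset.univ.filter (fun c : SubIdx (2 ^ k) => ¬ IntP k c),
          (∑ p : Fin (N + 1), (subCell ℓ c).indicator (fun _ => (1 : ℝ≥0∞)) (X p)) * (‖Ψ.ψ X‖₊ : ℝ≥0∞) ^ 2 :=
        (lintegral_finsetSum _ fun c _ => (hcnt c).mul hnorm).symm
    _ = ∫⁻ X, wallCount ℓ k X * (‖Ψ.ψ X‖₊ : ℝ≥0∞) ^ 2 := by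
        refine lintegral_congr fun X => ?_
        rw [wallCount, Finset.sum_mul]
    _ ≤ ∫⁻ X, ENNReal.ofReal (12 * 4 ^ k * (4 * ℓ / a + 2) ^ 3) * (‖Ψ.ψ X‖₊ : ℝ≥0∞) ^ 2 :=
        lintegral_mono fun X => wallCount_mul_le ha hcore Ψ hE hℓ k X
    _ = ENNReal.ofReal (12 * 4 ^ k * (4 * ℓ / a + 2) ^ 3) * ∫⁻ X, (‖Ψ.ψ X‖₊ : ℝ≥0∞) ^ 2 := by
        rw [lintegral_const_mul' _ _ ENNReal.ofReal_ne_top]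
    _ = ENNReal.ofReal (12 * 4 ^ k * (4 * ℓ / a + 2) ^ 3) := by rw [Ψ.norm_eq, mul_one]

/-! ## Constants and the crux body -/

/-- window arithmetic: with `ℓ = L/2^k ≥ 1/√ρ` and `L³ = N/ρ`,
`12·4^k·(4ℓ/a+2)³ ≤ (12(4/a+2√ρ)³/ρ) · (1/2)^k · N`. -/
theorem wall_const_le {a ρ L : ℝ} {N k : ℕ} (ha : 0 < a) (hρ : 0 < ρ) (hL3 : L ^ 3 = N / ρ)
    (hℓρ : 1 / Real.sqrt ρ ≤ L / 2 ^ k) :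
    12 * 4 ^ k * (4 * (L / 2 ^ k) / a + 2) ^ 3 ≤ 12 * (4 / a + 2 * Real.sqrt ρ) ^ 3 / ρ * (1 / 2) ^ k * N := by
  set ℓ := L / 2 ^ k with hℓdef
  have hsq : 0 < Real.sqrt ρ := Real.sqrt_pos.2 hρ
  have hℓ : 0 < ℓ := lt_of_lt_of_le (by positivity) hℓρ
  have h1 : 1 ≤ Real.sqrt ρ * ℓ := by
    have := mul_le_mul_of_nonneg_left hℓρ hsq.le
    rwa [mul_one_div_cancel hsq.ne'] at this
  have h2 : 4 * ℓ / a + 2 ≤ (4 / a + 2 * Real.sqrt ρ) * ℓ := by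
    have : 2 ≤ 2 * Real.sqrt ρ * ℓ := by nlinarith
    have h8 : 4 * ℓ / a = 4 / a * ℓ := by ring
    nlinarith [h8]
  have h3 : (4 * ℓ / a + 2) ^ 3 ≤ ((4 / a + 2 * Real.sqrt ρ) * ℓ) ^ 3 :=
    pow_le_pow_left₀ (by positivity) h2 3
  have hℓ3 : ℓ ^ 3 = L ^ 3 / 8 ^ k := by
    rw [hℓdef, div_pow, ← pow_mul, show (2 : ℝ) ^ (k * 3) = 8 ^ k by rw [mul_comm, pow_mul]; norm_num]
  have hN : L ^ 3 = N / ρ := hL3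
  calc 12 * 4 ^ k * (4 * ℓ / a + 2) ^ 3 ≤ 12 * 4 ^ k * ((4 / a + 2 * Real.sqrt ρ) * ℓ) ^ 3 := by
        gcongr
    _ = 12 * (4 / a + 2 * Real.sqrt ρ) ^ 3 * (4 ^ k * ℓ ^ 3) := by ring
    _ = 12 * (4 / a + 2 * Real.sqrt ρ) ^ 3 / ρ * (1 / 2) ^ k * N := by
        rw [hℓ3, hN]
        have h8 : (8 : ℝ) ^ k = 4 ^ k * 2 ^ k := by rw [← mul_pow]; norm_num
        rw [h8, one_div_pow]
        field_simp

/-- **`WallLayerMass` for hard cores** (the crux body at a finite-range `v` with a genuine hard core; `A = 12(4/a+2√ρ)³/ρ`,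
`q = 1/2`, `δ = 1`, escape unused). The `Finset.filter` predicate is the route's literal one. -/
theorem wallLayerMass_of_hardCore {a : ℝ} (ha : 0 < a) {v : ℝ → ℝ≥0∞} (hv : IsRepulsiveFiniteRange v)
    (hcore : ∀ r, r < a → v r = ⊤) :
    ∃ ρ₀ : ℝ, 0 < ρ₀ ∧ ∀ ρ : ℝ, 0 < ρ → ρ < ρ₀ → ∃ A : ℝ, 0 < A ∧ ∃ q : ℝ, 0 < q ∧ q < 1 ∧ ∃ c₀ : ℝ, 0 < c₀ ∧
      ∀ᶠ N : ℕ in Filter.atTop, ∃ δ : ENNReal, 0 < δ ∧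
        ∀ Ψ : TrialState N (sideLength ρ N), energy v Ψ ≤ groundStateEnergy v N (sideLength ρ N) + δ →
          ENNReal.ofReal (c₀ * N) ≤ maxOccupation N Ψ.ψ ∨
            ∀ K k : ℕ, 1 / Real.sqrt ρ ≤ sideLength ρ N / 2 ^ K → sideLength ρ N / 2 ^ K < 2 * (1 / Real.sqrt ρ) →
              1 ≤ k → k ≤ K →
              ∑ c ∈ Finset.univ.filter (fun c : SubIdx (2 ^ k) =>
                  ¬ (∀ j : Fin 3, 1 ≤ (c j : ℕ) / 2 ∧ (c j : ℕ) / 2 + 2 ≤ 2 ^ (k - 1))),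
                ∫⁻ x in subCell (sideLength ρ N / 2 ^ k) c, oneParticleDensity N Ψ.ψ x ≤
                ENNReal.ofReal (A * q ^ k * N) := by
  obtain ⟨ρ₁, hρ₁, H⟩ := eventually_groundStateEnergy_lt_top hv
  refine ⟨ρ₁, hρ₁, fun ρ hρ hρlt => ⟨12 * (4 / a + 2 * Real.sqrt ρ) ^ 3 / ρ, by positivity, 1 / 2, by norm_num,
    by norm_num, 1, one_pos, ?_⟩⟩
  filter_upwards [H ρ hρ hρlt, Filter.eventually_ge_atTop 1] with N hfin hN1
  refine ⟨1, one_pos, fun Ψ hΨ => Or.inr fun K k hK1 _ _ hkK => ?_⟩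
  obtain ⟨n, rfl⟩ : ∃ n, N = n + 1 := ⟨N - 1, by omega⟩
  have hE : energy v Ψ ≠ ⊤ := (lt_of_le_of_lt hΨ (ENNReal.add_lt_top.2 ⟨hfin, ENNReal.one_lt_top⟩)).ne
  have hsq : 0 < Real.sqrt ρ := Real.sqrt_pos.2 hρ
  have hLK : 0 < sideLength ρ (n + 1) / 2 ^ K := lt_of_lt_of_le (by positivity) hK1
  have hL : 0 < sideLength ρ (n + 1) := sideLength_pos_of_pos hρ (Nat.succ_pos n)
  have hℓ : 0 < sideLength ρ (n + 1) / 2 ^ k := by positivity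
  have hℓρ : 1 / Real.sqrt ρ ≤ sideLength ρ (n + 1) / 2 ^ k := by
    refine hK1.trans ?_
    exact div_le_div_of_nonneg_left hL.le (by positivity) (pow_le_pow_right₀ (by norm_num) hkK)
  have hL3 : sideLength ρ (n + 1) ^ 3 = ((n + 1 : ℕ) : ℝ) / ρ := by
    have h := div_sideLength_pow_three hρ (Nat.succ_pos n)
    have hL3pos : 0 < sideLength ρ (n + 1) ^ 3 := by positivity
    field_simp at h
    field_simp
    linarith
  refine (wallMass_le ha hcore Ψ hE hℓ k).trans (ENNReal.ofReal_le_ofReal ?_)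
  exact wall_const_le ha hρ hL3 hℓρ

/-- … in particular for the hard-sphere gas `hardCorePotential a`. -/
theorem wallLayerMass_hardCorePotential {a : ℝ} (ha : 0 < a) :
    ∃ ρ₀ : ℝ, 0 < ρ₀ ∧ ∀ ρ : ℝ, 0 < ρ → ρ < ρ₀ → ∃ A : ℝ, 0 < A ∧ ∃ q : ℝ, 0 < q ∧ q < 1 ∧ ∃ c₀ : ℝ, 0 < c₀ ∧
      ∀ᶠ N : ℕ in Filter.atTop, ∃ δ : ENNReal, 0 < δ ∧
        ∀ Ψ : TrialState N (sideLength ρ N), energy (hardCorePotential a) Ψ ≤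
            groundStateEnergy (hardCorePotential a) N (sideLength ρ N) + δ →
          ENNReal.ofReal (c₀ * N) ≤ maxOccupation N Ψ.ψ ∨
            ∀ K k : ℕ, 1 / Real.sqrt ρ ≤ sideLength ρ N / 2 ^ K → sideLength ρ N / 2 ^ K < 2 * (1 / Real.sqrt ρ) →
              1 ≤ k → k ≤ K →
              ∑ c ∈ Finset.univ.filter (fun c : SubIdx (2 ^ k) =>
                  ¬ (∀ j : Fin 3, 1 ≤ (c j : ℕ) / 2 ∧ (c j : ℕ) / 2 + 2 ≤ 2 ^ (k - 1))),
                ∫⁻ x in subCell (sideLength ρ N / 2 ^ k) c, oneParticleDensity N Ψ.ψ x ≤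
                ENNReal.ofReal (A * q ^ k * N) :=
  wallLayerMass_of_hardCore ha (isRepulsiveFiniteRange_hardCorePotential a) (fun _ hr => hardCorePotential_of_lt hr)

end Summit.AtomisticToContinuum.BoseEinsteinCondensation.Theorems.NumberPhaseSandwichHardCoreWall

end
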